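import Literature.NumberTheory.LFunctions.MertensElementary
import Mathlib.NumberTheory.Harmonic.EulerMascheroni
import Literature.NumberTheory.LFunctions.PolynomialRootChebyshev
import Literature.NumberTheory.Sieve.PolynomialCongruencesMeanValues

/-!
# SoloInformedRootMertensConstant — Mertens' first theorem along an irreducible `g ∈ ℤ[X]`, WITH ITS CONSTANT

Solo unit `solo-Parity-informed` (ideation tier, informed mode), session 19; `PLAN.md` §27, CLAIMS C92.

For `g ∈ ℤ[X]` irreducible of positive degree, with `ρ_g(e) = #{ν mod e : g(ν) ≡ 0}`
(`polyRootCountMod ![g] e`), there are real constants `γ_g` and `K` with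

  `|∑_{e ≤ N} Λ(e) ρ_g(e)/e - (log N - γ_g)| ≤ K / log N`   for every `N ≥ 3`

(`RootMertens.exists_abs_sum_vonMangoldt_rootCount_div_sub_le`). For `g = X` this is Mertens' first theorem with
de la Vallée-Poussin's constant [Poussin1899; MontgomeryVaughan2007, §2.2]; in general `γ_g` is the "Mertens
constant of `g`" (for `X² + 1` numerically `≈ 1.6269`; not evaluated in closed form here).

## Method (elementary and discrete — Abel summation, no integrals)

* `RootMertens.exists_abs_sum_div_sub_log_sub_le` — discrete de la Vallée-Poussin lemma: `|A(n) - n| ≤ C n/log² n`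
  for `A(n) = ∑_{m ≤ n} c(m)` gives `∑_{n ≤ N} c(n)/n = log N + m + O((3C+1)/log N)` (Abel summation
  `sum_div_eq_abel`, the telescoping majorant `1/(n log² n) ≤ 1/log(n-1) - 1/log n`, Mathlib's sandwich
  `0 < H_N - log N - γ < 1/N`, summable tail).
* `RootMertens.exists_abs_psiRoot_sub_self_le` — `∑_{m ≤ n} Λ(m) ρ_g(m) = n + O(n/log² n)` from the prime ideal
  theorem along `g` with a `log²` saving (`DegreeOnePrimes.abs_thetaRoot_sub_self_le` [LandauMathAnn1903]) and
  `ρ_g(p^a) ≤ deg g · M` on the prime powers (`exists_rootCount_primePow_le`, `Chebyshev.psi_sub_theta_le`).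

This is the input WITH CONSTANT that the located von Mangoldt layer (`SoloInformedLocatedMangoldt`) needs.
-/

namespace Summit.Parity.BatemanHorn.Theorems

open Finset Filter ArithmeticFunction Asymptotics Polynomial
open scoped Topology Chebyshev
open Literature.NumberTheory.Sieve (polyRootCountMod)

namespace RootMertens

/-! ### Discrete Abel summation; Mertens' first theorem with its constant from a `log²` saving -/

/-- Abel summation: `∑_{n ≤ N} c(n)/n = A(N)/N + ∑_{1 ≤ n < N} A(n)/(n(n+1))` with `A(n) = ∑_{m ≤ n} c(m)`. -/
theorem sum_div_eq_abel (c : ℕ → ℝ) (N : ℕ) :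
    ∑ n ∈ Icc 1 N, c n / n =
      (∑ n ∈ Icc 1 N, c n) / N + ∑ n ∈ Ico 1 N, (∑ m ∈ Icc 1 n, c m) / ((n : ℝ) * (n + 1)) := by
  induction N with
  | zero => simp
  | succ N ih =>
    rw [sum_Icc_succ_top (by omega), ih, sum_Icc_succ_top (by omega)]
    rcases Nat.eq_zero_or_pos N with rfl | hN
    · simp
    · rw [sum_Ico_succ_top hN]
      set A := ∑ n ∈ Icc 1 N, c n
      set S := ∑ n ∈ Ico 1 N, (∑ m ∈ Icc 1 n, c m) / ((n : ℝ) * (n + 1))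
      have hN0 : (N : ℝ) ≠ 0 := by positivity
      have hN1 : ((N : ℝ) + 1) ≠ 0 := by positivity
      push_cast
      field_simp
      ring

/-- `1/(m log² m) ≤ 1/log(m-1) - 1/log m` for `m ≥ 3`. -/
theorem inv_mul_log_sq_le {m : ℕ} (hm : 3 ≤ m) :
    1 / ((m : ℝ) * Real.log m ^ 2) ≤ 1 / Real.log ((m : ℝ) - 1) - 1 / Real.log m := by
  have hmR : (3 : ℝ) ≤ m := by exact_mod_cast hm
  have hL1 : 0 < Real.log ((m : ℝ) - 1) := Real.log_pos (by linarith)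
  have hL : 0 < Real.log (m : ℝ) := Real.log_pos (by linarith)
  have hL1L : Real.log ((m : ℝ) - 1) ≤ Real.log m := Real.log_le_log (by linarith) (by linarith)
  have hm0 : (0 : ℝ) < m := by linarith
  have hm1 : (0 : ℝ) < (m : ℝ) - 1 := by linarith
  have hdiff : 1 / (m : ℝ) ≤ Real.log m - Real.log ((m : ℝ) - 1) := by
    rw [← Real.log_div hm0.ne' hm1.ne']
    have h := Real.one_sub_inv_le_log_of_pos (x := (m : ℝ) / (m - 1)) (div_pos hm0 hm1)
    have h1 : 1 - ((m : ℝ) / (m - 1))⁻¹ = 1 / m := by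
      have := hm0.ne'
      have := hm1.ne'
      rw [inv_div]
      field_simp
      ring
    linarith
  calc 1 / ((m : ℝ) * Real.log m ^ 2) = (1 / (m : ℝ)) / (Real.log m * Real.log m) := by
        rw [div_div, sq]
    _ ≤ (1 / (m : ℝ)) / (Real.log ((m : ℝ) - 1) * Real.log m) :=
        div_le_div_of_nonneg_left (by positivity) (by positivity)
          (mul_le_mul_of_nonneg_right hL1L hL.le)
    _ ≤ (Real.log m - Real.log ((m : ℝ) - 1)) / (Real.log ((m : ℝ) - 1) * Real.log m) :=
        div_le_div_of_nonneg_right hdiff (by positivity)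
    _ = 1 / Real.log ((m : ℝ) - 1) - 1 / Real.log m := by
        field_simp

/-- Telescoping: `∑_{N ≤ m < M} (1/log(m-1) - 1/log m) = 1/log(N-1) - 1/log(M-1)` (`3 ≤ N ≤ M`). -/
theorem sum_Ico_telescope {N M : ℕ} (hNM : N ≤ M) :
    ∑ m ∈ Ico N M, (1 / Real.log ((m : ℝ) - 1) - 1 / Real.log m) =
      1 / Real.log ((N : ℝ) - 1) - 1 / Real.log ((M : ℝ) - 1) := by
  induction M, hNM using Nat.le_induction with
  | base => simp
  | succ M hNM ih =>
    rw [sum_Ico_succ_top hNM, ih]; push_cast; ring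

/-- `∑_{N ≤ m < M} 1/(m log² m) ≤ 1/log(N-1)` for `N ≥ 3`. -/
theorem sum_Ico_inv_mul_log_sq_le {N M : ℕ} (hN : 3 ≤ N) :
    ∑ m ∈ Ico N M, 1 / ((m : ℝ) * Real.log m ^ 2) ≤ 1 / Real.log ((N : ℝ) - 1) := by
  rcases le_or_gt M N with hMN | hMN
  · rw [Ico_eq_empty_of_le hMN, sum_empty]
    have : (3 : ℝ) ≤ N := by exact_mod_cast hN
    exact div_nonneg zero_le_one (Real.log_nonneg (by linarith))
  · calc ∑ m ∈ Ico N M, 1 / ((m : ℝ) * Real.log m ^ 2)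
        ≤ ∑ m ∈ Ico N M, (1 / Real.log ((m : ℝ) - 1) - 1 / Real.log m) :=
          sum_le_sum fun m hm => inv_mul_log_sq_le (hN.trans (mem_Ico.mp hm).1)
      _ = 1 / Real.log ((N : ℝ) - 1) - 1 / Real.log ((M : ℝ) - 1) := sum_Ico_telescope hMN.le
      _ ≤ 1 / Real.log ((N : ℝ) - 1) := by
          have : (3 : ℝ) + 1 ≤ M := by exact_mod_cast (show 3 + 1 ≤ M by omega)
          have : 0 ≤ 1 / Real.log ((M : ℝ) - 1) := div_nonneg zero_le_one (Real.log_nonneg (by linarith))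
          linarith

/-- `(harmonic N : ℝ) = 1 + ∑_{1 ≤ n < N} 1/(n+1)` for `N ≥ 1`. -/
theorem harmonic_eq_one_add_sum_Ico {N : ℕ} (hN : 1 ≤ N) :
    (harmonic N : ℝ) = 1 + ∑ n ∈ Ico 1 N, 1 / ((n : ℝ) + 1) := by
  induction N, hN using Nat.le_induction with
  | base => simp [harmonic_succ]
  | succ N hN ih =>
    rw [harmonic_succ, Rat.cast_add, ih, sum_Ico_succ_top hN]; push_cast; ring

/-- `0 ≤ H_N - log N - γ ≤ 1/N` for `N ≥ 1` (Mathlib's monotone sandwich of `γ`). -/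
theorem abs_harmonic_sub_log_sub_eulerMascheroni_le {N : ℕ} (hN : 1 ≤ N) :
    |(harmonic N : ℝ) - Real.log N - Real.eulerMascheroniConstant| ≤ 1 / N := by
  have hN0 : (0 : ℝ) < N := by exact_mod_cast hN
  have h1 : Real.eulerMascheroniConstant < (harmonic N : ℝ) - Real.log N := by
    have := Real.eulerMascheroniConstant_lt_eulerMascheroniSeq' N
    simpa [Real.eulerMascheroniSeq', show N ≠ 0 by omega] using this
  have h2 : (harmonic N : ℝ) - Real.log (N + 1) < Real.eulerMascheroniConstant := by
    have := Real.eulerMascheroniSeq_lt_eulerMascheroniConstant N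
    simpa [Real.eulerMascheroniSeq] using this
  have h3 : Real.log ((N : ℝ) + 1) - Real.log N ≤ 1 / N := by
    rw [← Real.log_div (by positivity) hN0.ne']
    have := Real.log_le_sub_one_of_pos (x := ((N : ℝ) + 1) / N) (by positivity)
    have h4 : ((N : ℝ) + 1) / N - 1 = 1 / N := by
      field_simp
      ring
    linarith
  rw [abs_le]
  constructor <;> linarith

/-- **Mertens' first theorem with its constant from a `log²`-saving Chebyshev estimate** (discrete de la
Vallée-Poussin): if `|∑_{m ≤ n} c(m) - n| ≤ C n / log² n` for all `n ≥ 2`, then there is a constant `m` with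
`|∑_{n ≤ N} c(n)/n - log N - m| ≤ (3C + 1)/log N` for all `N ≥ 3`. -/
theorem exists_abs_sum_div_sub_log_sub_le {c : ℕ → ℝ} {C : ℝ} (hC : 0 ≤ C)
    (hA : ∀ n : ℕ, 2 ≤ n → |∑ m ∈ Icc 1 n, c m - n| ≤ C * n / Real.log n ^ 2) :
    ∃ m : ℝ, ∀ N : ℕ, 3 ≤ N →
      |∑ n ∈ Icc 1 N, c n / n - Real.log N - m| ≤ (3 * C + 1) / Real.log N := by
  set A : ℕ → ℝ := fun n => ∑ m ∈ Icc 1 n, c m with hAdef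
  set e : ℕ → ℝ := fun n => (A n - n) / ((n : ℝ) * (n + 1)) with hedef
  -- `|e n| ≤ C/(n log² n)` for `n ≥ 2`
  have he : ∀ n : ℕ, 2 ≤ n → |e n| ≤ C * (1 / ((n : ℝ) * Real.log n ^ 2)) := by
    intro n hn
    have hn0 : (0 : ℝ) < n := by exact_mod_cast (show 0 < n by omega)
    have hl : 0 < Real.log n := Real.log_pos (by exact_mod_cast (show 1 < n by omega))
    simp only [hedef]
    rw [abs_div, abs_of_pos (by positivity : (0 : ℝ) < n * (n + 1))]
    calc |A n - n| / (n * (n + 1)) ≤ (C * n / Real.log n ^ 2) / (n * (n + 1)) :=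
          div_le_div_of_nonneg_right (hA n hn) (by positivity)
      _ = C / ((n + 1) * Real.log n ^ 2) := by
          field_simp
      _ ≤ C / (n * Real.log n ^ 2) :=
          div_le_div_of_nonneg_left hC (by positivity)
            (mul_le_mul_of_nonneg_right (by linarith) (sq_nonneg _))
      _ = C * (1 / (n * Real.log n ^ 2)) := by rw [mul_one_div]
  -- a telescoping majorant
  set b : ℕ → ℝ := fun n =>
    if n < 3 then |e n| else C * (1 / Real.log ((n : ℝ) - 1) - 1 / Real.log n) with hbdef
  have hb3 : ∀ n : ℕ, 3 ≤ n → b n = C * (1 / Real.log ((n : ℝ) - 1) - 1 / Real.log n) := by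
    intro n hn
    simp only [hbdef, show ¬ n < 3 by omega, if_false]
  have heb : ∀ n, |e n| ≤ b n := by
    intro n
    by_cases h : n < 3
    · simp only [hbdef, h, if_true, le_refl]
    · push Not at h
      rw [hb3 n h]
      exact (he n (by omega)).trans (mul_le_mul_of_nonneg_left (inv_mul_log_sq_le h) hC)
  have hb0 : ∀ n, 0 ≤ b n := fun n => (abs_nonneg _).trans (heb n)
  have hlog2 : 0 < Real.log 2 := Real.log_pos one_lt_two
  -- tails of the majorant: `∑_{N ≤ n < N + M} b n ≤ C / log (N-1)` for `N ≥ 3`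
  have hbtail : ∀ N M : ℕ, 3 ≤ N → ∑ n ∈ range M, b (n + N) ≤ C * (1 / Real.log ((N : ℝ) - 1)) := by
    intro N M hN
    have h1 : ∑ n ∈ range M, b (n + N) = ∑ n ∈ Ico N (N + M), b n := by
      rw [sum_Ico_eq_sum_range, Nat.add_sub_cancel_left]
      exact sum_congr rfl fun n _ => by rw [add_comm]
    rw [h1]
    calc ∑ n ∈ Ico N (N + M), b n
        = ∑ n ∈ Ico N (N + M), C * (1 / Real.log ((n : ℝ) - 1) - 1 / Real.log n) :=
          sum_congr rfl fun n hn => hb3 n (hN.trans (mem_Ico.mp hn).1)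
      _ = C * (1 / Real.log ((N : ℝ) - 1) - 1 / Real.log (((N + M : ℕ) : ℝ) - 1)) := by
          rw [← mul_sum, sum_Ico_telescope (Nat.le_add_right N M)]
      _ ≤ C * (1 / Real.log ((N : ℝ) - 1)) := by
          have : (3 : ℝ) ≤ ((N + M : ℕ) : ℝ) := by exact_mod_cast (show 3 ≤ N + M by omega)
          have : 0 ≤ 1 / Real.log (((N + M : ℕ) : ℝ) - 1) :=
            div_nonneg zero_le_one (Real.log_nonneg (by linarith))
          nlinarith
  -- partial sums of `b` are bounded, so `b` and `e` are summable
  have hbsum : ∀ M : ℕ, ∑ n ∈ range M, b n ≤ (b 0 + b 1 + b 2) + C * (1 / Real.log 2) := by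
    intro M
    rcases le_or_gt M 3 with hM | hM
    · calc ∑ n ∈ range M, b n ≤ ∑ n ∈ range 3, b n :=
            sum_le_sum_of_subset_of_nonneg (range_mono hM) fun n _ _ => hb0 n
        _ = b 0 + b 1 + b 2 := by simp [sum_range_succ]
        _ ≤ _ := le_add_of_nonneg_right (by positivity)
    · have hsplit : ∑ n ∈ range M, b n = ∑ n ∈ range 3, b n + ∑ n ∈ range (M - 3), b (n + 3) := by
        have := (sum_range_add_sum_Ico b (show 3 ≤ M by omega)).symm
        rw [this, sum_Ico_eq_sum_range]
        congr 1
        exact sum_congr rfl fun n _ => by rw [add_comm]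
      rw [hsplit]
      have h3 := hbtail 3 (M - 3) le_rfl
      rw [show ((3 : ℕ) : ℝ) - 1 = 2 by norm_num] at h3
      have : ∑ n ∈ range 3, b n = b 0 + b 1 + b 2 := by simp [sum_range_succ]
      linarith
  have hbs : Summable b := summable_of_sum_range_le hb0 hbsum
  have hes : Summable e := hbs.of_norm_bounded fun n => by rw [Real.norm_eq_abs]; exact heb n
  -- the constant
  refine ⟨Real.eulerMascheroniConstant + ∑' n, e n, fun N hN => ?_⟩
  have hN1 : 1 ≤ N := by omega
  have hN0 : (0 : ℝ) < N := by exact_mod_cast (show 0 < N by omega)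
  have hNR : (3 : ℝ) ≤ N := by exact_mod_cast hN
  have hlogN : 1 < Real.log N :=
    Literature.NumberTheory.LFunctions.MertensBound.one_lt_log_three.trans_le (Real.log_le_log (by norm_num) hNR)
  have hlogN' : Real.log N ≤ N := (Real.log_le_sub_one_of_pos hN0).trans (by linarith)
  -- Abel summation and the decomposition `A(n)/(n(n+1)) = 1/(n+1) + e(n)`
  have hmain : ∑ n ∈ Icc 1 N, c n / n =
      A N / N + (∑ n ∈ Ico 1 N, 1 / ((n : ℝ) + 1)) + ∑ n ∈ range N, e n := by
    rw [sum_div_eq_abel]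
    have h1 : ∑ n ∈ Ico 1 N, (∑ m ∈ Icc 1 n, c m) / ((n : ℝ) * (n + 1)) =
        ∑ n ∈ Ico 1 N, (1 / ((n : ℝ) + 1) + e n) := by
      refine sum_congr rfl fun n hn => ?_
      have hn : (0 : ℝ) < n := by exact_mod_cast (mem_Ico.mp hn).1
      simp only [hedef, hAdef]
      field_simp
      ring
    have h2 : ∑ n ∈ range N, e n = ∑ n ∈ Ico 1 N, e n := by
      rw [range_eq_Ico, ← sum_Ico_consecutive e (Nat.zero_le 1) hN1]
      simp [hedef, hAdef]
    rw [h1, sum_add_distrib, h2]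
    ring
  -- the three error terms
  have hE1 : |A N / N - 1| ≤ C / Real.log N := by
    have h := hA N (by omega)
    rw [show A N / N - 1 = (A N - N) / N by field_simp, abs_div, abs_of_pos hN0,
      div_le_div_iff₀ hN0 (by linarith)]
    calc |A N - N| * Real.log N ≤ (C * N / Real.log N ^ 2) * Real.log N :=
          mul_le_mul_of_nonneg_right h (by linarith)
      _ = C * N / Real.log N := by field_simp
      _ ≤ C * N := div_le_self (by positivity) hlogN.le
  have hE2 : |(harmonic N : ℝ) - Real.log N - Real.eulerMascheroniConstant| ≤ 1 / Real.log N :=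
    (abs_harmonic_sub_log_sub_eulerMascheroni_le hN1).trans
      (div_le_div_of_nonneg_left zero_le_one (by linarith) hlogN')
  have hE3 : |∑' n, e n - ∑ n ∈ range N, e n| ≤ 2 * C / Real.log N := by
    have htail : ∑' n, e n - ∑ n ∈ range N, e n = ∑' n, e (n + N) := by
      rw [← hes.sum_add_tsum_nat_add N]
      ring
    rw [htail]
    have hesN : Summable fun n => e (n + N) := (summable_nat_add_iff N).mpr hes
    have hbsN : Summable fun n => b (n + N) := (summable_nat_add_iff N).mpr hbs
    have hup : ∑' n, e (n + N) ≤ ∑' n, b (n + N) :=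
      hesN.tsum_le_tsum (fun n => (le_abs_self _).trans (heb _)) hbsN
    have hlo : -∑' n, b (n + N) ≤ ∑' n, e (n + N) := by
      rw [← tsum_neg]
      exact hbsN.neg.tsum_le_tsum (fun n => (neg_le.mp ((neg_le_abs _).trans (heb _)))) hesN
    have hB : ∑' n, b (n + N) ≤ C * (1 / Real.log ((N : ℝ) - 1)) :=
      Real.tsum_le_of_sum_range_le (fun n => hb0 _) fun M => hbtail N M hN
    -- `1/log(N-1) ≤ 2/log N` since `N ≤ (N-1)²`
    have hlogN1 : Real.log N ≤ 2 * Real.log ((N : ℝ) - 1) := by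
      rw [show (2 : ℝ) * Real.log ((N : ℝ) - 1) = Real.log (((N : ℝ) - 1) ^ 2) by
        rw [Real.log_pow]; norm_num]
      exact Real.log_le_log hN0 (by nlinarith)
    have hl1 : 0 < Real.log ((N : ℝ) - 1) := Real.log_pos (by linarith)
    have hB' : C * (1 / Real.log ((N : ℝ) - 1)) ≤ 2 * C / Real.log N := by
      rw [mul_one_div, div_le_div_iff₀ hl1 (by linarith)]
      nlinarith
    rw [abs_le]
    constructor <;> linarith
  -- assemble
  have hsplit : ∑ n ∈ Icc 1 N, c n / n - Real.log N - (Real.eulerMascheroniConstant + ∑' n, e n) =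
      (A N / N - 1) + ((harmonic N : ℝ) - Real.log N - Real.eulerMascheroniConstant)
        - (∑' n, e n - ∑ n ∈ range N, e n) := by
    rw [hmain, harmonic_eq_one_add_sum_Ico hN1]
    ring
  rw [hsplit]
  calc |A N / N - 1 + ((harmonic N : ℝ) - Real.log N - Real.eulerMascheroniConstant)
        - (∑' n, e n - ∑ n ∈ range N, e n)|
      ≤ |A N / N - 1 + ((harmonic N : ℝ) - Real.log N - Real.eulerMascheroniConstant)|
        + |∑' n, e n - ∑ n ∈ range N, e n| := abs_sub _ _
    _ ≤ |A N / N - 1| + |(harmonic N : ℝ) - Real.log N - Real.eulerMascheroniConstant|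
        + |∑' n, e n - ∑ n ∈ range N, e n| := add_le_add (abs_add_le _ _) le_rfl
    _ ≤ C / Real.log N + 1 / Real.log N + 2 * C / Real.log N := by gcongr
    _ = (3 * C + 1) / Real.log N := by ring

/-! ### Mertens' first theorem along `g`, with its constant -/

/-- `ψ_g(n) := ∑_{m ≤ n} Λ(m) ρ_g(m) = n + O(n / log² n)`: the prime ideal theorem along `g`
(`abs_thetaRoot_sub_self_le`) plus the prime powers, which carry `≤ deg g · M · (ψ(n) - θ(n)) ≤ 2 dM √n log n`. -/
theorem exists_abs_psiRoot_sub_self_le {g : ℤ[X]} (hirr : Irreducible g) (hdeg : 0 < g.natDegree) :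
    ∃ C : ℝ, 0 ≤ C ∧ ∀ n : ℕ, 2 ≤ n →
      |∑ m ∈ Icc 1 n, Λ m * (polyRootCountMod ![g] m : ℝ) - n| ≤ C * n / Real.log n ^ 2 := by
  obtain ⟨C, hC0, hC⟩ :=
    Literature.NumberTheory.LFunctions.DegreeOnePrimes.abs_thetaRoot_sub_self_le hirr hdeg
  obtain ⟨M, hM1, hM, -⟩ := Literature.NumberTheory.Sieve.exists_rootCount_primePow_le hirr hdeg
  set K : ℝ := ((g.natDegree * M : ℕ) : ℝ) with hK
  have hK0 : 0 ≤ K := Nat.cast_nonneg _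
  refine ⟨C + 432 * K, by positivity, fun n hn => ?_⟩
  have hn0 : (0 : ℝ) < n := by exact_mod_cast (show 0 < n by omega)
  have hn1 : (1 : ℝ) ≤ n := by exact_mod_cast (show 1 ≤ n by omega)
  have hlog : 0 < Real.log n := Real.log_pos (by exact_mod_cast (show 1 < n by omega))
  set ρ : ℕ → ℝ := fun m => (polyRootCountMod ![g] m : ℝ) with hρ
  -- primes / non-primes
  have hP : (Icc 1 n).filter (fun m => m.Prime) = Nat.primesLE n := by
    ext p
    simp only [mem_filter, mem_Icc, Nat.mem_primesLE]
    constructor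
    · rintro ⟨⟨-, hp⟩, hpr⟩
      exact ⟨hp, hpr⟩
    · rintro ⟨hp, hpr⟩
      exact ⟨⟨hpr.one_le, hp⟩, hpr⟩
  have hsplit : ∑ m ∈ Icc 1 n, Λ m * ρ m =
      ∑ p ∈ Nat.primesLE ⌊(n : ℝ)⌋₊, ρ p * Real.log p
        + ∑ m ∈ (Icc 1 n).filter (fun m => ¬ m.Prime), Λ m * ρ m := by
    rw [Nat.floor_natCast, ← sum_filter_add_sum_filter_not (Icc 1 n) (fun m => m.Prime), hP]
    congr 1
    refine sum_congr rfl fun p hp => ?_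
    rw [vonMangoldt_apply_prime (Nat.mem_primesLE.mp hp).2, mul_comm]
  have hNP0 : 0 ≤ ∑ m ∈ (Icc 1 n).filter (fun m => ¬ m.Prime), Λ m * ρ m :=
    sum_nonneg fun m _ => mul_nonneg vonMangoldt_nonneg (Nat.cast_nonneg _)
  have hNP : ∑ m ∈ (Icc 1 n).filter (fun m => ¬ m.Prime), Λ m * ρ m ≤ K * (ψ (n : ℝ) - θ (n : ℝ)) := by
    rw [Chebyshev.psi_sub_theta_eq_sum_not_prime, Nat.floor_natCast, mul_sum]
    have hI : Icc 1 n = Ioc 0 n := by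
      ext m
      simp only [mem_Icc, mem_Ioc]
      omega
    rw [hI]
    refine sum_le_sum fun m _ => ?_
    by_cases hpp : IsPrimePow m
    · obtain ⟨p, a, hp, ha, rfl⟩ := hpp
      have h := hM p hp.nat_prime a
      have h' : ρ (p ^ a) ≤ K := by
        simp only [hρ, hK]
        exact_mod_cast h
      calc Λ (p ^ a) * ρ (p ^ a) ≤ Λ (p ^ a) * K := mul_le_mul_of_nonneg_left h' vonMangoldt_nonneg
        _ = K * Λ (p ^ a) := mul_comm _ _
    · rw [vonMangoldt_eq_zero_iff.mpr hpp]
      simp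
  -- `2 √n log n ≤ 432 n / log² n`
  have hcheb : ψ (n : ℝ) - θ (n : ℝ) ≤ 432 * n / Real.log n ^ 2 := by
    refine (Chebyshev.psi_sub_theta_le hn1).trans ?_
    have h6 : Real.log n ≤ 6 * (n : ℝ) ^ (1 / 6 : ℝ) := by
      have := Real.log_le_rpow_div hn0.le (by norm_num : (0 : ℝ) < 1 / 6)
      linarith
    have h3 : Real.log n ^ 3 ≤ 216 * Real.sqrt n := by
      calc Real.log n ^ 3 ≤ (6 * (n : ℝ) ^ (1 / 6 : ℝ)) ^ 3 := by gcongr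
        _ = 216 * ((n : ℝ) ^ (1 / 6 : ℝ)) ^ (3 : ℕ) := by ring
        _ = 216 * Real.sqrt n := by
            rw [← Real.rpow_natCast, ← Real.rpow_mul hn0.le, Real.sqrt_eq_rpow]
            norm_num
    rw [le_div_iff₀ (by positivity)]
    have hs : Real.sqrt n * Real.sqrt n = n := Real.mul_self_sqrt hn0.le
    have hs0 : 0 ≤ Real.sqrt n := Real.sqrt_nonneg _
    nlinarith
  -- assemble
  rw [hsplit, add_sub_right_comm]
  calc |∑ p ∈ Nat.primesLE ⌊(n : ℝ)⌋₊, ρ p * Real.log p - n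
          + ∑ m ∈ (Icc 1 n).filter (fun m => ¬ m.Prime), Λ m * ρ m|
      ≤ |∑ p ∈ Nat.primesLE ⌊(n : ℝ)⌋₊, ρ p * Real.log p - n|
          + |∑ m ∈ (Icc 1 n).filter (fun m => ¬ m.Prime), Λ m * ρ m| := abs_add_le _ _
    _ ≤ C * n / Real.log n ^ 2 + K * (432 * n / Real.log n ^ 2) := by
        refine add_le_add (hC n (by exact_mod_cast hn)) ?_
        rw [abs_of_nonneg hNP0]
        exact hNP.trans (mul_le_mul_of_nonneg_left hcheb hK0)
    _ = (C + 432 * K) * n / Real.log n ^ 2 := by ring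

/-- **Mertens' first theorem along `g`, with its constant** (de la Vallée-Poussin form): for `g ∈ ℤ[X]`
irreducible of positive degree there are `γ_g` and `K` with
`|∑_{e ≤ N} Λ(e) ρ_g(e)/e - (log N - γ_g)| ≤ K / log N` for all `N ≥ 3`. -/
theorem exists_abs_sum_vonMangoldt_rootCount_div_sub_le {g : ℤ[X]} (hirr : Irreducible g)
    (hdeg : 0 < g.natDegree) :
    ∃ γ K : ℝ, ∀ N : ℕ, 3 ≤ N →
      |∑ e ∈ Icc 1 N, Λ e * (polyRootCountMod ![g] e : ℝ) / e - (Real.log N - γ)| ≤ K / Real.log N := by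
  obtain ⟨C, hC0, hC⟩ := exists_abs_psiRoot_sub_self_le hirr hdeg
  obtain ⟨m, hm⟩ := exists_abs_sum_div_sub_log_sub_le hC0 hC
  refine ⟨-m, 3 * C + 1, fun N hN => ?_⟩
  have h := hm N hN
  rwa [show Real.log N - -m = Real.log N + m by ring, ← sub_sub]

end RootMertens

end Summit.Parity.BatemanHorn.Theorems
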